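import Summits.CriticalPhenomena.SAWScalingLimit.Theses.SAWTrackTransport
import Literature.Probability.RandomPlanarGeometry.YangBaxterSAWYBE
import Summits.CriticalPhenomena.SAWScalingLimit.Theorems.SAWDevelopingMapHexTransferThirdBdryEndpointsGeometry
import HarnessLib

/-!
# Sketch — crux idea `crossing-rotation` for `MirrorRotation` (stmt-CriticalPhenomena-16997)

Lever: the ORIENTATION-PRESERVING inter-angle isomorphism of Glazman–Manolescu's columnar tilings
`R_{α,δ} : T_α → T_{π−α}`, `z ↦ ρ_α z − (iδ/2)(1 − ρ_α)`, `ρ_α = e^{i(π−α)}` (face map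
`(k, j) ↦ (−j−1, k)`, mid-edge map `vert k j ↦ slant (−j−1) k`, `slant k j ↦ vert (−j) k`, side
4-cycle `W ↦ S ↦ E ↦ N ↦ W`, arc kinds `corner ↔ coCorner`), which is WEIGHT-PRESERVING between the
critical weights at angle `α` and at angle `π − α` by GM's crossing symmetry
`u₁(π−θ) = u₂(θ)`, `w₁(π−θ) = w₂(θ)`, `v(π−θ) = v(θ)` (tree: `weightU1_pi_sub` … `weightW2_pi_sub`,
`YangBaxterSAWYBE.lean`).  With `RL α P` and `RL (π−α) P` (both from AngleUniversality) it gives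
`P (ρ_α D) = (ρ_α)_* (P D)` for EVERY rotation angle `π − α ∈ [π/3, 2π/3]` directly, and twelve equal
such rotations compose to any rotation — no mirror, no `conj`, no mirror composition.

This file: the finite core PROVED (`arcKind_rSide`, `localWeight_cross`, the intertwining identity
`planeMidpoint_rEdge`), and the line's statements as `Prop`s that elaborate (first lemma
`CrossingWalks`; transfer form `CrossingRotationCovariance`; `RotationsGenerate`), plus the glue
`mirrorRotation_of_crossing` (kernel-checked) showing they conclude the crux BY NAME.
-/

noncomputable section

open MeasureTheory Filter Topology Real
open Complex (I)
open Literature.Probability.RandomPlanarGeometry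
open Literature.Probability.RandomPlanarGeometry.SAW.YangBaxter
open Summit.CriticalPhenomena.SAWScalingLimit.Cruxes.HexTransfer.YbRelay.ThirdEndpoints (colOffset_const planeCorner_const)

namespace Summit.CriticalPhenomena.SAWScalingLimit.Cruxes.MirrorRotation.CrossingRotation

/-! ### Finite core (proved) -/

/-- The side 4-cycle of the crossing rotation: `W ↦ S ↦ E ↦ N ↦ W`. -/
def rSide : Side → Side
  | .W => .S
  | .S => .E
  | .E => .N
  | .N => .W

/-- `corner ↔ coCorner` (straight and degenerate fixed). -/
def cross : ArcKind → ArcKind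
  | .corner => .coCorner
  | .coCorner => .corner
  | .straight => .straight
  | .degen => .degen

@[simp] theorem cross_cross (κ : ArcKind) : cross (cross κ) = κ := by cases κ <;> rfl

/-- Under the side 4-cycle, arc kinds are crossed: `θ`-corner arcs become `(π−θ)`-corner arcs. -/
theorem arcKind_rSide (s t : Side) : arcKind (rSide s) (rSide t) = cross (arcKind s t) := by
  cases s <;> cases t <;> rfl

/-- **Crossing symmetry of the local Yang–Baxter weights** (GM §1, "replacing `θ` by `π − θ`
exchanges `u₁` with `u₂` and `w₁` with `w₂`, but does not affect `v`"): the local weight at angle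
`π − θ` of the crossed arc configuration is the local weight at angle `θ`. -/
theorem localWeight_cross (θ : ℝ) : ∀ l : List ArcKind,
    localWeight (π - θ) (l.map cross) = localWeight θ l
  | [] => rfl
  | [a] => by
    cases a <;> simp [localWeight, cross, weightU1_pi_sub, weightU2_pi_sub, weightV_pi_sub]
  | [a, b] => by
    cases a <;> cases b <;> simp [localWeight, cross, weightW1_pi_sub, weightW2_pi_sub]
  | a :: b :: c :: l => by
    simp [localWeight]

/-- The face map of the crossing rotation: `(k, j) ↦ (−j−1, k)` (a quarter-turn of the INDEX lattice). -/
def rFace (f : Face) : Face := (-f.2 - 1, f.1)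

/-- The mid-edge map of the crossing rotation. -/
def rEdge : MidEdge → MidEdge
  | .vert k j => .slant (-j - 1) k
  | .slant k j => .vert (-j) k

/-- Consistency of `rEdge` with `rFace` and the side 4-cycle: the image of the `s`-side of `f` is the
`rSide s`-side of `rFace f`. -/
theorem rEdge_side (f : Face) (s : Side) : rEdge (Face.side f s) = Face.side (rFace f) (rSide s) := by
  obtain ⟨k, j⟩ := f
  cases s <;> (simp [rEdge, rFace, rSide, Face.side]; try ring)

/-- `ρ_α = e^{i(π−α)} = −cos α + i sin α`, spelled with real trigonometric functions. -/
def rho (α : ℝ) : ℂ := -(Real.cos α : ℂ) + (Real.sin α : ℂ) * I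

/-- The offset `t_α = −(i + w_{π−α})/2`, `w_{π−α} = sin α + i cos α` (`‖t_α‖ = cos(α/2) ≤ 1`). -/
def tOff (α : ℝ) : ℂ := -(I + ((Real.sin α : ℂ) + (Real.cos α : ℂ) * I)) / 2

/-- **The intertwining identity (G1 at mesh 1), proved**: the crossing rotation maps the mid-edge
embedding of the angle-`α` tiling onto that of the angle-`(π−α)` tiling. -/
theorem planeMidpoint_rEdge (α : ℝ) (x : MidEdge) :
    planeMidpoint (fun (_ : ℤ) => π - α) (rEdge x) = rho α * planeMidpoint (fun (_ : ℤ) => α) x + tOff α := by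
  have hsc : Complex.sin α ^ 2 + Complex.cos α ^ 2 = 1 := Complex.sin_sq_add_cos_sq (α : ℂ)
  cases x with
  | vert k j =>
    simp only [rEdge, planeMidpoint, planeCorner_const, colShift, Real.sin_pi_sub, Real.cos_pi_sub, rho, tOff]
    push_cast
    linear_combination (-(k : ℂ) * I) * hsc + ((k : ℂ) * Complex.sin α * Complex.cos α - Complex.sin α * (j : ℂ)) * Complex.I_sq
  | slant k j =>
    simp only [rEdge, planeMidpoint, planeCorner_const, colShift, Real.sin_pi_sub, Real.cos_pi_sub, rho, tOff]
    push_cast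
    linear_combination (-((k : ℂ) + 1 / 2) * I) * hsc
      + (((k : ℂ) + 1 / 2) * Complex.sin α * Complex.cos α - ((j : ℂ) - 1 / 2) * Complex.sin α) * Complex.I_sq


/-- `ρ_α` is the exponential `e^{i(π−α)}`. -/
theorem rho_eq_exp (α : ℝ) : rho α = Complex.exp (((π - α : ℝ) : ℂ) * I) := by
  rw [Complex.exp_mul_I, ← Complex.ofReal_cos, ← Complex.ofReal_sin, Real.cos_pi_sub, Real.sin_pi_sub, rho]
  push_cast
  ring

/-- `‖ρ_α‖ = 1`. -/
theorem norm_rho (α : ℝ) : ‖rho α‖ = 1 := by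
  rw [rho_eq_exp]
  exact Complex.norm_exp_ofReal_mul_I _

theorem rho_ne_zero (α : ℝ) : rho α ≠ 0 := fun h => by simpa [h] using norm_rho α

/-- `‖t_α‖ ≤ 1` (in fact `= cos(α/2)`): the lattice rotation is `|δ|`-close to the rotation about `0`. -/
theorem norm_tOff_le (α : ℝ) : ‖tOff α‖ ≤ 1 := by
  have h1 : ‖I + ((Real.sin α : ℂ) + (Real.cos α : ℂ) * I)‖ ≤ 2 := by
    calc ‖I + ((Real.sin α : ℂ) + (Real.cos α : ℂ) * I)‖
        ≤ ‖I‖ + ‖(Real.sin α : ℂ) + (Real.cos α : ℂ) * I‖ := norm_add_le _ _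
      _ = 1 + 1 := by
          rw [Complex.norm_I]
          congr 1
          have : (Real.sin α : ℂ) + (Real.cos α : ℂ) * I = Complex.exp (((π / 2 - α : ℝ) : ℂ) * I) := by
            rw [Complex.exp_mul_I, ← Complex.ofReal_cos, ← Complex.ofReal_sin, Real.cos_pi_div_two_sub,
              Real.sin_pi_div_two_sub]
          rw [this]
          exact Complex.norm_exp_ofReal_mul_I _
      _ = 2 := by norm_num
  unfold tOff
  rw [norm_div, norm_neg]
  simp only [RCLike.norm_ofNat]
  linarith

/-! ### The statements of the line (elaborating `Prop`s; NOT registered — ideation stage) -/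

/-- The route's robust-full-limit predicate `RL α P` (verbatim the `let RL := …` of the route file). -/
def RL (α : ℝ) (P : ChordalFamily) : Prop :=
  ∀ (D : DobrushinDomain) (u : ℝ → ℂ) (a b : ℝ → MidEdge), (∀ᶠ δ in 𝓝[>] (0 : ℝ), ‖u δ‖ ≤ δ) →
    (∀ᶠ δ in 𝓝[>] (0 : ℝ), Nonempty (YangBaxterSAW (fun (_ : ℤ) => α)
      ((D.map (similarity 1 one_ne_zero (u δ))).carrier) δ (a δ) (b δ))) →
    Tendsto (fun δ : ℝ => (δ : ℂ) * planeMidpoint (fun (_ : ℤ) => α) (a δ)) (𝓝[>] (0 : ℝ))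
      (𝓝 (D.pt 0)) →
    Tendsto (fun δ : ℝ => (δ : ℂ) * planeMidpoint (fun (_ : ℤ) => α) (b δ)) (𝓝[>] (0 : ℝ))
      (𝓝 (D.pt 1)) →
    TendstoLaw (fun δ (γ : YangBaxterSAW (fun (_ : ℤ) => α)
        ((D.map (similarity 1 one_ne_zero (u δ))).carrier) δ (a δ) (b δ)) =>
        γ.curve (fun (_ : ℤ) => α) δ)
      (fun δ => ybLaw (fun (_ : ℤ) => α) ((D.map (similarity 1 one_ne_zero (u δ))).carrier) δ 1
        (a δ) (b δ)) id (P D)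

/-- The lattice rotation `R_{α,δ} : z ↦ ρ_α z + δ t_α`, an orientation-preserving `similarity`; `R_{α,0}` is
the rotation by `π − α` about the origin. -/
abbrev latticeRot (α δ : ℝ) : ℂ ≃ₜ ℂ := similarity (rho α) (rho_ne_zero α) ((δ : ℂ) * tOff α)

/-- **First lemma (S1′, `CrossingWalks`)** — the crossing rotation is a weight-CROSSING equivalence of
Glazman–Manolescu walk types: walks of the face set `D` at angle `α` ↔ walks of `rFace '' D` at angle
`π − α`, edge lists mapped by `rEdge`, `w_{π−α}(e γ) = w_α(γ)`.  Intended proof: `Cx.Emb (gridCx α) Kᴿ D`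
into the side-RELABELLED grid complex `Kᴿ` (`side f s := Face.side f (rSide s)`,
`sideOf f e := (Face.sideOf f e).map rSide⁻¹`, angle `α`), whose `IsWalk` is `gridCx`'s (`noncross` is
invariant under the 4-cycle) and whose weight is `(gridCx (π − α)).weight` by `arcKind_rSide` +
`localWeight_cross`; then `Emb.isWalk_map_iff`, `Emb.weight_map`, `YBWalk.isWalk_mids/ofIsWalk`. -/
def CrossingWalks : Prop :=
  ∀ (α : ℝ) (D : Set Face) (a z : MidEdge),
    ∃ e : YBWalk D a z ≃ YBWalk (rFace '' D) (rEdge a) (rEdge z),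
      ∀ γ : YBWalk D a z, (e γ).mids = γ.mids.map rEdge ∧
        (e γ).weight (fun (_ : ℤ) => π - α) = γ.weight (fun (_ : ℤ) => α)

/-- **S2′ (`CrossingGeometry`)** — plane geometry of `R_{α,δ}`: (G1) it intertwines the rescaled mid-edge
embeddings (mesh-1 case PROVED above: `planeMidpoint_rEdge`), (G2) it carries the discretisation of `Ω`
at angle `α` onto that of `R_{α,δ} Ω` at angle `π − α` (image of a rhombus is the rhombus of `rFace f`),
(G3) it is `|δ|`-close to the rotation `R_{α,0}` (`‖t_α‖ ≤ 1`, PROVED: `norm_tOff_le`), (G4) it is affine. -/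
def CrossingGeometry : Prop :=
  ∀ α δ : ℝ,
    (∀ x : MidEdge, (δ : ℂ) * planeMidpoint (fun (_ : ℤ) => π - α) (rEdge x) =
        latticeRot α δ ((δ : ℂ) * planeMidpoint (fun (_ : ℤ) => α) x)) ∧
    (∀ Ω : Set ℂ, meshFaces (fun (_ : ℤ) => π - α) (latticeRot α δ '' Ω) δ =
        rFace '' meshFaces (fun (_ : ℤ) => α) Ω δ) ∧
    (∀ z : ℂ, dist (latticeRot α δ z) (latticeRot α 0 z) ≤ |δ|) ∧
    (∀ (x y : ℂ) (t : ℝ), latticeRot α δ (AffineMap.lineMap x y t) =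
        AffineMap.lineMap (latticeRot α δ x) (latticeRot α δ y) t)

/-- **Transfer form C⁺ (`CrossingRotationCovariance`)** — the hypothesis-minimal two-angle statement the
line actually proves: a chordal `P` that is the robust full limit of the critical Yang–Baxter walk at
angle `α` AND at angle `π − α` is covariant under the rotation by `π − α` about the origin. -/
def CrossingRotationCovariance : Prop :=
  ∀ α ∈ Set.Icc (π / 3) (2 * π / 3), ∀ P : ChordalFamily, P.IsChordal → RL α P → RL (π - α) P →
    (∀ D : DobrushinDomain, ∃ a b : ℝ → MidEdge, IsYBEndpointApprox (fun (_ : ℤ) => α) D a b) →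
    ∀ D : DobrushinDomain,
      P (D.map (latticeRot α 0)) = (P D).map (CurveClass.map (latticeRot α 0 : C(ℂ, ℂ)))

/-- **S5′ (`RotationsGenerate`)** — covariance under the rotations by every angle of `[π/3, 2π/3]` gives
covariance under every rotation about the origin (`rot θ = rot((θ + 6π)/12)^{12}`,
`(θ + 6π)/12 ∈ (5π/12, 7π/12]` for `θ = arg c`). -/
def RotationsGenerate : Prop :=
  ∀ P : ChordalFamily,
    (∀ θ ∈ Set.Icc (π / 3) (2 * π / 3), ∀ D : DobrushinDomain,
      P (D.map (similarity (Complex.exp ((θ : ℂ) * I)) (Complex.exp_ne_zero _) 0)) =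
        (P D).map (CurveClass.map
          (similarity (Complex.exp ((θ : ℂ) * I)) (Complex.exp_ne_zero _) 0 : C(ℂ, ℂ)))) →
    ∀ (D : DobrushinDomain) (c : ℂ) (hc : c ≠ 0), ‖c‖ = 1 →
      P (D.map (similarity c hc 0)) = (P D).map (CurveClass.map (similarity c hc 0 : C(ℂ, ℂ)))

/-! ### Glue (kernel-checked): the line concludes the crux BY NAME -/

/-- The rotation `R_{π−θ,0}` is the rotation by `θ`. -/
theorem latticeRot_pi_sub_zero (θ : ℝ) :
    latticeRot (π - θ) 0 = similarity (Complex.exp ((θ : ℂ) * I)) (Complex.exp_ne_zero _) 0 := by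
  ext z
  simp [rho_eq_exp, sub_sub_cancel]

/-- **Glue.** `CrossingRotationCovariance → RotationsGenerate → MirrorRotation`: angle universality
supplies `RL α P` and `RL (π − α) P` for every `α ∈ [π/3, 2π/3]` from `RL (π/2) P`; C⁺ gives covariance
under the rotation by `π − α`, i.e. by every `θ ∈ [π/3, 2π/3]`; S5′ gives every rotation.  Uses AU at TWO
angles per rotation, EA at the source angle, `IsChordal` (inside C⁺); no mirror, no conjugation. -/
theorem mirrorRotation_of_crossing (hC : CrossingRotationCovariance) (hG : RotationsGenerate) :
    Summit.CriticalPhenomena.SAWScalingLimit.Theses.SAWTrackTransport.MirrorRotation := by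
  intro hAU hEA P hP hRL D c hc hc1
  refine hG P ?_ D c hc hc1
  intro θ hθ D'
  have hα : π - θ ∈ Set.Icc (π / 3) (2 * π / 3) := by
    obtain ⟨h1, h2⟩ := hθ
    constructor <;> linarith
  have h1 : RL (π - θ) P := hAU (π - θ) hα P hP hRL
  have h2 : RL (π - (π - θ)) P := by
    rw [sub_sub_cancel]
    exact hAU θ hθ P hP hRL
  have key := hC (π - θ) hα P hP h1 h2 (hEA (π - θ) hα) D'
  rw [latticeRot_pi_sub_zero] at key
  exact key

end Summit.CriticalPhenomena.SAWScalingLimit.Cruxes.MirrorRotation.CrossingRotation
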